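import Summits.HodgeConjecture.HodgeConjecture.Theses.HeightMassDefect
import Summits.HodgeConjecture.HodgeConjecture.Theorems.HeightMassDefectSectionRestrictionSurface
import Summits.HodgeConjecture.HodgeConjecture.Theorems.LinearSystemTorelliMiddleDivisorSupportFourfoldPairingSplit
import Summits.HodgeConjecture.HodgeConjecture.Theorems.LimitExtensionMiddleDivisorSupportSufficesProof
import Summits.HodgeConjecture.HodgeConjecture.Theorems.EndoscopicMiddleDegreeIsotypicMiddleClassesAlgebraicStubTopGysinInjective
import Literature.AlgebraicGeometry.HodgeTheory.SupportedHodgeClassesAlgebraic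
import Literature.AlgebraicGeometry.HodgeTheory.HodgeTypePullback
import Literature.AlgebraicGeometry.HodgeTheory.HardLefschetzHodgeRiemannHolds
import Literature.AlgebraicGeometry.HodgeTheory.GysinKernelSplitHolds
import Literature.AlgebraicGeometry.HodgeTheory.GysinFormalismPushforward
import Literature.AlgebraicGeometry.HodgeTheory.SupportedClassesHodgeConiveauHolds
import Literature.AlgebraicGeometry.Motives.ComplexPointsOrientation
import HarnessLib

/-!
# Route HeightMassDefect — assembly item `Assembly` (stmt-HodgeConjecture-2518), PROVED:
# `SectionRestriction → HodgeConjecture`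

Kerr–Pearlstein 2011, Thm. 42 ("if" direction, without normal functions) = Brosnan–Fang–Nie–Pearlstein
2009, Thm. 52, combined with Thomas 2005, Prop. 2: if every non-zero rational middle Hodge class on
every even-dimensional smooth projective complex variety restricts non-trivially to some hypersurface
section (`SectionRestriction`), then the Hodge conjecture holds. The theorem
`heightMassDefect_assembly_proof` has literally the type of the route decl
`Summit.HodgeConjecture.HodgeConjecture.Theses.HeightMassDefect.Assembly`; with the landed converse
`heightMassDefect_sectionRestriction_of_hodgeConjecture` the landing pad is EQUIVALENT to the summit
statement (`heightMassDefect_sectionRestriction_iff_hodgeConjecture`).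

Proof — strong induction on the dimension `n`, inner induction on the codimension `p` (the induction
skeleton of the tree's `hodgeConjectureFor_of_descent_of_pencilReduction`, with the middle step
replaced). Every input is a THEOREM of the tree; no definition, no named-fact hypothesis, no sorry.

* `p = 0`: `hodgeConjectureFor_codim_zero`.
* `0 < 2p < n` (below the middle): the pencil step `mem_algebraicClasses_of_two_mul_le` (Thomas 2005
  Prop. 2 / de Cataldo–Migliorini 2009 Prop. 4.5, a theorem of the tree), fed with the Hodge conjecture
  in dimension `n - 1`.
* `2p > n` (above the middle): such classes die off a hyperplane section
  (`mem_supportedClasses_one_of_dim_lt`, Andreotti–Frankel) and descend by divisor induction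
  (`descent_of_divisorInduction` with the closed item `limitExtension_divisorInduction_proof`:
  Deligne Hodge III 8.2.7/8.2.8, Gysin lift of Hodge classes), fed with the Hodge conjecture below `n`.
* `2p = n` (THE MIDDLE, `heightMassDefect_middle_of_sectionRestriction`), BFNP §6 in dimension `2k`:
  1. DETECTION (`heightMassDefect_map_eq_zero_of_forall_cupProduct_eq_zero_of_lt`): a rational
     `(k,k)`-class `c` cup-orthogonal to `Algᵏ(X) = supportedClasses X (2k) k` pulls back to zero along
     every `g : Y ⟶ X` from a smooth projective `Y` of dimension `d < 2k` satisfying the Hodge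
     conjecture: were `g^* c ≠ 0`, the perfect pairing on Hodge classes of `Y` (BFNP (6.1),
     `hardLefschetz_hodgeRiemann_holds.hodgeClasses_cupPairing_nondegenerate`) gives a rational
     `(d-k, d-k)` partner `s` with `g^* c ∪ s ≠ 0 ∈ H^{2d}(Y(ℂ))`; `s` is algebraic on `Y`, so
     `g_* s ∈ Algᵏ(X)` (`complexGysin_mem_supportedClasses`) and `0 = c ∪ g_* s = g_* (g^* c ∪ s)`
     (projection formula `complexGysin_cup`), contradicting the injectivity of the top-degree Gysin map
     (`stub_topGysinInjective`).
  2. VANISHING ON PROPER CLOSED SUBSETS (`heightMassDefect_restrict_eq_zero_of_forall_cupProduct_eq_zero_of_lt`):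
     with the Hodge conjecture below `2k`, such a `c` dies on `Z(ℂ)` for every Zariski-closed `Z ⊊ X`
     (desingularise the components of `Z` by Hironaka, `exists_family_iUnion_range_eq_of_isClosed`;
     Deligne Hodge III Prop. 8.2.7 `Deligne1974_ker_pullback_eq_ker_pullback_resolution_holds`;
     functoriality of restriction).
  3. `SectionRestriction` therefore forbids non-zero `Algᵏ`-orthogonal rational `(k,k)`-classes, and the
     PAIRING SPLIT (`heightMassDefect_pairingSplit`, the `ℚ`-dimension count of the tree's
     `pairingSplit_finrank_span_le` in dimension `2k`: `H^{4k}(X(ℂ)) ≅ ℂ`, rational cup products on one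
     `ℚ`-line, `Algᵏ ⊆ H^{k,k}` by `Grothendieck1969_supportedClasses_le_hodgeConiveau_holds`) gives
     `Hdgᵏ(X) ⊆ Algᵏ(X)`.
* The Hodge model conjunct: `nonempty_hodgeModel_holds`.

References: [KerrPearlstein2011] Conj. 41, Thm. 42; [BrosnanFangNiePearlstein2009] §6 (6.1), Lemma 48,
Thm. 52; [Thomas2005Nodes] Prop. 2 and §3 Rem. 1; [DecataldoMigliorini2009] §4; [DeligneHodgeIII1974]
Prop. 8.2.7, Cor. 8.2.8; [VoisinHodgeI2002] Thm. 6.32, §7.1.2; [GrothendieckTopology1969] p. 300.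
-/

noncomputable section

-- every declaration of this problem lives in `Summit.HodgeConjecture.HodgeConjecture.…` (summit = sub-problem)
set_option linter.dupNamespace false

namespace Summit.HodgeConjecture.HodgeConjecture.Theorems

open CategoryTheory AlgebraicGeometry
open Literature.AlgebraicGeometry Literature.AlgebraicGeometry.Motives Literature.AlgebraicGeometry.HodgeTheory
open Literature.AlgebraicTopology.SingularHomology
open Summit.HodgeConjecture.HodgeConjecture.Theses.HeightMassDefect (SectionRestriction Assembly)

/-- Degree bookkeeping for the middle pairing `H^{2k} ∪ H^{2k} → H^{4k}`. -/
theorem heightMassDefect_two_mul_add_two_mul (k : ℕ) : 2 * k + 2 * k = 2 * (2 * k) := by ring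

/-! ### The pairing split in dimension `2k` (BFNP §6, sentence after (6.1)) -/

/-- **Pairing split in dimension `2k`.** On a smooth projective complex `2k`-fold `X`, if every
non-zero rational `(k,k)`-class pairs non-trivially (cup product into `H^{4k}(X(ℂ); ℂ)`) with some
class of `Algᵏ(X) = supportedClasses X (2k) k`, then every rational `(k,k)`-class lies in `Algᵏ(X)`.
The `ℚ`-dimension count of the tree's `pairingSplit_finrank_span_le`: `Algᵏ` is the complex span of its
rational classes (`supportedClasses_eq_span_isRationalClass`), which are `(k,k)`-classes
(`Grothendieck1969_supportedClasses_le_hodgeConiveau_holds`); `H^{4k}(X(ℂ); ℂ) ≅ ℂ`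
(`pairingSplit_nonempty_topEquiv`) and cup products of rational classes are rational, hence on one
`ℚ`-line (`pairingSplit_exists_ratCast_mul`); so `dim span_ℂ Hdgᵏ ≤ dim Algᵏ` and `Algᵏ = span_ℂ Hdgᵏ`.
[cite: BrosnanFangNiePearlstein2009, §6 (6.1) and Lemma 48] [cite: GrothendieckTopology1969, p. 300] -/
theorem heightMassDefect_pairingSplit {k : ℕ} {X : SchemeOver ℂ} (hX : IsSmoothProjective (2 * k) X)
    (hP : ∀ c : complexBetti X (2 * k), IsRationalClass c → IsOfHodgeType (2 * k) X (2 * k) k k c →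
      c ≠ 0 → ∃ a ∈ supportedClasses X (2 * k) k,
        cupProduct (heightMassDefect_two_mul_add_two_mul k) c a ≠ 0)
    (c₀ : complexBetti X (2 * k)) (hc₀ : IsRationalClass c₀)
    (hH₀ : IsOfHodgeType (2 * k) X (2 * k) k k c₀) : c₀ ∈ supportedClasses X (2 * k) k := by
  obtain ⟨A, hA₀⟩ := hH₀
  -- the `(k,k)`-classes, read in the Hodge model `A` (legitimate: independence of the model)
  let T : Submodule ℂ (complexBetti X (2 * k)) := (A.hodgePQ (2 * k) k k).comap (A.pullback (2 * k)).hom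
  have hT : ∀ c : complexBetti X (2 * k), IsOfHodgeType (2 * k) X (2 * k) k k c ↔ c ∈ T := fun c ↦
    hodgePQ_independent_of_hodgeModel_holds.isOfHodgeType_iff hX A
  -- `Algᵏ ⊆ H^{k,k}`: the coniveau fact in degree `2k`, codimension `k`
  have hST : supportedClasses X (2 * k) k ≤ T := by
    intro a ha
    have h1 : A.pullback (2 * k) a ∈ A.hodgeConiveau (2 * k) k :=
      Grothendieck1969_supportedClasses_le_hodgeConiveau_holds hX A (2 * k) k ⟨a, ha, rfl⟩
    have hle : A.hodgeConiveau (2 * k) k ≤ A.hodgePQ (2 * k) k k := by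
      refine iSup_le fun p ↦ iSup_le fun q ↦ iSup_le fun hpq ↦ iSup_le fun hp ↦
        iSup_le fun hq ↦ ?_
      obtain ⟨rfl, rfl⟩ : p = k ∧ q = k := ⟨by omega, by omega⟩
      exact le_rfl
    exact hle h1
  -- the rational `(k,k)`-classes `H` and the rational algebraic classes `Aset`
  let H : Set (complexBetti X (2 * k)) := {c | IsRationalClass c ∧ c ∈ T}
  let Aset : Set (complexBetti X (2 * k)) :=
    {c | IsRationalClass c ∧ c ∈ supportedClasses X (2 * k) k}
  have hSA : supportedClasses X (2 * k) k = Submodule.span ℂ Aset :=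
    supportedClasses_eq_span_isRationalClass hX (2 * k) k
  have hAH : Aset ⊆ H := fun a ha ↦ ⟨ha.1, hST ha.2⟩
  have hSH : supportedClasses X (2 * k) k ≤ Submodule.span ℂ H := by
    rw [hSA]
    exact Submodule.span_mono hAH
  -- topology of `X(ℂ)`: `H^{2k}` is finite-dimensional and `H^{4k}` is a line
  haveI : FiniteDimensional ℂ (complexBetti X (2 * k)) := finite_complexBetti hX (2 * k)
  obtain ⟨e⟩ : Nonempty (complexBetti X (2 * (2 * k)) ≃ₗ[ℂ] ℂ) := pairingSplit_nonempty_topEquiv hX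
  obtain ⟨t, ht⟩ := pairingSplit_exists_ratCast_mul e
  -- the dimension count
  have hrank : Module.finrank ℂ (Submodule.span ℂ H) ≤
      Module.finrank ℂ (Submodule.span ℂ Aset) := by
    refine pairingSplit_finrank_span_le (cupProduct (heightMassDefect_two_mul_add_two_mul k)) e t
      ⟨IsRationalClass.zero, Submodule.zero_mem _⟩
      (fun x hx y hy ↦ ⟨hx.1.add hy.1, Submodule.add_mem _ hx.2 hy.2⟩)
      (fun q x hx ↦ ⟨hx.1.smul q, Submodule.smul_mem _ _ hx.2⟩)
      (fun x hx y hy ↦ ht _ (hx.1.cup _ hy.1)) ?_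
    intro x hx hx0
    by_contra hne
    obtain ⟨a, ha, hxa⟩ := hP x hx.1 ((hT x).2 hx.2) hne
    -- `x ∪ ·` vanishes on `Aset`, hence on its span `Algᵏ`
    have hker : supportedClasses X (2 * k) k ≤
        LinearMap.ker (cupProduct (heightMassDefect_two_mul_add_two_mul k) x) := by
      rw [hSA]
      exact Submodule.span_le.2 fun y hy ↦ LinearMap.mem_ker.2 (hx0 y hy)
    exact hxa (LinearMap.mem_ker.1 (hker ha))
  -- conclusion: `Algᵏ = span_ℂ H ∋ c₀`
  have hEq : supportedClasses X (2 * k) k = Submodule.span ℂ H := by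
    refine Submodule.eq_of_le_of_finrank_le hSH ?_
    rw [hSA]
    exact hrank
  rw [hEq]
  exact Submodule.subset_span ⟨hc₀, hA₀⟩

/-! ### Detection: an `Algᵏ`-orthogonal rational `(k,k)`-class dies on every lower-dimensional variety satisfying the Hodge conjecture -/

/-- **Detection** (BFNP §6 proof of Thm. 52 / de Cataldo–Migliorini §4, general even dimension).
Let `X` be a smooth projective complex `2k`-fold, `c ∈ H^{2k}(X(ℂ); ℂ)` a rational `(k,k)`-class
cup-orthogonal to `Algᵏ(X) = supportedClasses X (2k) k`, and `g : Y ⟶ X` a morphism from a smooth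
projective `Y` of dimension `d < 2k` on which the Hodge conjecture (cycle part) holds. Then
`g^* c = 0`: for `d < k` because `H^{2k}(Y(ℂ); ℂ) = 0`; for `d = k + l`, were `g^* c ≠ 0`, BFNP (6.1)
on `Y` gives a rational `(l,l)` partner `s` with `g^* c ∪ s ≠ 0 ∈ H^{2d}(Y(ℂ))`, `s` is algebraic,
`g_* s ∈ Algᵏ(X)` (`complexGysin_mem_supportedClasses`), `0 = c ∪ g_* s = g_* (g^* c ∪ s)`
(`complexGysin_cup`), and the top-degree Gysin map is injective (`stub_topGysinInjective`).
[cite: BrosnanFangNiePearlstein2009, §6 (6.1) and proof of Thm. 52] [cite: DecataldoMigliorini2009, §4]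
[cite: FultonYoungTableaux1997, Appendix B §B.1 (6)] -/
theorem heightMassDefect_map_eq_zero_of_forall_cupProduct_eq_zero_of_lt {k d : ℕ}
    {Y X : SchemeOver ℂ} (hY : IsSmoothProjective d Y) (hX : IsSmoothProjective (2 * k) X)
    (g : Y ⟶ X) (hd : d < 2 * k)
    (hHC : ∀ (q : ℕ) (a : complexBetti Y (2 * q)), IsRationalClass a →
      IsOfHodgeType d Y (2 * q) q q a → a ∈ algebraicClasses Y q)
    {c : complexBetti X (2 * k)} (hc : IsRationalClass c) (hh : IsOfHodgeType (2 * k) X (2 * k) k k c)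
    (hno : ∀ a ∈ supportedClasses X (2 * k) k,
      cupProduct (heightMassDefect_two_mul_add_two_mul k) c a = 0) :
    complexBetti.map g (2 * k) c = 0 := by
  rcases Nat.lt_or_ge d k with hdk | hdk
  · -- `dim Y < k`: `H^{2k}(Y(ℂ); ℂ) = 0`
    haveI := subsingleton_complexBetti hY (k := 2 * k) (by omega)
    exact Subsingleton.elim _ _
  obtain ⟨l, rfl⟩ := Nat.exists_eq_add_of_le hdk
  -- an orientation family, with Poincaré duality
  let μ : OrientationFamily := fun _ _ h ↦ (ComplexPoints.isOrientableOver ℂ h).some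
  have hμ : μ.HasPoincareDuality := μ.hasPoincareDuality
  -- `g^* c` is a rational `(k,k)`-class on `Y`
  have htQ : IsRationalClass (complexBetti.map g (2 * k) c) := hc.pullback _
  have htH : IsOfHodgeType (k + l) Y (2 * k) k k (complexBetti.map g (2 * k) c) :=
    hh.map_of_le hY hX (nonempty_hodgeModel_holds.nonempty hY).some g (by omega)
  by_contra hne
  -- BFNP (6.1) on `Y`: a rational `(l,l)` partner `s`
  obtain ⟨s, hsQ, hsH, hts⟩ :=
    (hardLefschetz_hodgeRiemann_holds (d := k + l) (X := Y)).hodgeClasses_cupPairing_nondegenerate hY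
      (2 * (k + l)) (rfl : k + l = k + l) (show 2 * k + 2 * l = 2 * (k + l) by ring) _ htQ htH hne
  -- `s` is algebraic on `Y`, so `g_* s ∈ Algᵏ(X)`
  have hsA : s ∈ supportedClasses Y (2 * l) l := hHC l s hsQ hsH
  have hgs : complexGysin μ hY hX g (show 2 * l + 2 * (2 * k) = 2 * k + 2 * (k + l) by ring) s ∈
      supportedClasses X (2 * k) k :=
    complexGysin_mem_supportedClasses (gysinMap_restrictCompl_eq_zero_of_field ℂ) μ hμ hY hX g _
      (r := l) (s := k) (by omega) hsA
  -- projection formula: `g_* (g^* c ∪ s) = c ∪ g_* s = 0`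
  have h1 : complexGysin μ hY hX g
      (show 2 * (k + l) + 2 * (2 * k) = 2 * (2 * k) + 2 * (k + l) by ring)
      (cupProduct (show 2 * k + 2 * l = 2 * (k + l) by ring) (complexBetti.map g (2 * k) c) s) = 0 := by
    rw [complexGysin_cup hμ hY hX g (show 2 * k + 2 * l = 2 * (k + l) by ring)
      (show 2 * (k + l) + 2 * (2 * k) = 2 * (2 * k) + 2 * (k + l) by ring)
      (show 2 * l + 2 * (2 * k) = 2 * k + 2 * (k + l) by ring)
      (heightMassDefect_two_mul_add_two_mul k) c s]
    exact hno _ hgs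
  -- the top-degree Gysin map `H^{2d}(Y(ℂ)) → H^{4k}(X(ℂ))` is injective
  exact hts (stub_topGysinInjective μ hμ hY hX g
    (show 2 * (k + l) + 2 * (2 * k) = 2 * (2 * k) + 2 * (k + l) by ring) rfl
    (h1.trans (map_zero _).symm))

/-- **Vanishing on proper closed subsets.** Let `X` be a smooth projective complex `2k`-fold such
that the Hodge conjecture (cycle part) holds for all smooth projective varieties of dimension `< 2k`,
and `c` a rational `(k,k)`-class cup-orthogonal to `Algᵏ(X)`. Then `c` restricts to zero on the
complex points of every Zariski-closed `Z ≠ X`: desingularise the components of `Z` (Hironaka,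
`exists_family_iUnion_range_eq_of_isClosed`), kill the pull-backs
(`heightMassDefect_map_eq_zero_of_forall_cupProduct_eq_zero_of_lt`), descend to an open neighbourhood
of `Z(ℂ)` with Deligne's Hodge III Prop. 8.2.7 (`Deligne1974_ker_pullback_eq_ker_pullback_resolution_holds`)
and restrict further by functoriality. [cite: DeligneHodgeIII1974, Prop. 8.2.7 and Cor. 8.2.8]
[cite: Thomas2005Nodes, §3 Remark 1] [cite: BrosnanFangNiePearlstein2009, §6 proof of Thm. 52] -/
theorem heightMassDefect_restrict_eq_zero_of_forall_cupProduct_eq_zero_of_lt {k : ℕ}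
    {X : SchemeOver ℂ} (hX : IsSmoothProjective (2 * k) X)
    (hHC : ∀ ⦃m : ℕ⦄ ⦃Y : SchemeOver ℂ⦄, m < 2 * k → IsSmoothProjective m Y →
      ∀ (q : ℕ) (a : complexBetti Y (2 * q)), IsRationalClass a →
        IsOfHodgeType m Y (2 * q) q q a → a ∈ algebraicClasses Y q)
    {c : complexBetti X (2 * k)} (hc : IsRationalClass c) (hh : IsOfHodgeType (2 * k) X (2 * k) k k c)
    (hno : ∀ a ∈ supportedClasses X (2 * k) k,
      cupProduct (heightMassDefect_two_mul_add_two_mul k) c a = 0)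
    {Z : Set X.left} (hZ : IsClosed Z) (hZu : Z ≠ Set.univ) :
    singularCohomology.map ℂ ℂ
      (⟨Subtype.val, continuous_subtype_val⟩ : C({P : ComplexPoints X // P.pt ∈ Z}, ComplexPoints X))
      (2 * k) c = 0 := by
  -- points of the proper closed `Z` have codimension `≥ 1`
  have hcod : ∀ z ∈ Z, (1 : ℕ∞) ≤ Order.coheight z :=
    fun z hz ↦ one_le_coheight_of_mem_of_isClosed hX hZ hZu hz
  -- desingularise the components of `Z` (Hironaka): `Z = ⋃ j, g_j(Y j)`, `dim Y j < 2k`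
  obtain ⟨ι, hι, m, Y, hY, g, hZg, hm⟩ :=
    exists_family_iUnion_range_eq_of_isClosed Resolution.Hironaka1964_projective_holds hX hZ
      (r := 1) hcod
  haveI := hι
  -- every pull-back `g_j^* c` vanishes
  have hg : ∀ j, complexBetti.map (g j) (2 * k) c = 0 := fun j ↦
    heightMassDefect_map_eq_zero_of_forall_cupProduct_eq_zero_of_lt (hY j) hX (g j) (by have := hm j; omega)
      (fun q a ha hH ↦ hHC (by have := hm j; omega) (hY j) q a ha hH) hc hh hno
  -- Deligne, Hodge III 8.2.7: `c` dies on an open neighbourhood `V` of `Z(ℂ)`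
  obtain ⟨V, -, hZV, hcV⟩ :=
    Deligne1974_ker_pullback_eq_ker_pullback_resolution_holds hX hY g (2 * k) c hg
  -- restrict further from `V` to `Z(ℂ)`
  have hsub : {P : ComplexPoints X | P.pt ∈ Z} ⊆ V := by
    intro P hP
    exact hZV (by simpa only [Set.mem_setOf_eq, hZg] using hP)
  have h0 : singularCohomology.map ℂ ℂ (subsetIncl {P : ComplexPoints X | P.pt ∈ Z}) (2 * k) c = 0 := by
    rw [show subsetIncl {P : ComplexPoints X | P.pt ∈ Z} = (subsetIncl V).comp (subsetInclusion hsub)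
      from rfl, singularCohomology.map_comp, ModuleCat.comp_apply, hcV, map_zero]
  exact h0

/-! ### The middle step -/

/-- **The middle step** (BFNP Thm. 52 / Kerr–Pearlstein Thm. 42 "if", in dimension `2k`, `k ≥ 1`).
Granted `SectionRestriction` and the Hodge conjecture (cycle part) for all smooth projective
varieties of dimension `< 2k`, every rational `(k,k)`-class on a smooth projective `2k`-fold `X` is
algebraic: a non-zero rational `(k,k)`-class orthogonal to `Algᵏ(X)` would die on every proper
closed subset (`heightMassDefect_restrict_eq_zero_of_forall_cupProduct_eq_zero_of_lt`), in particular
on the hypersurface section `Z = X ∩ V₊(F) ≠ X` on which `SectionRestriction` says it does not; so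
every non-zero Hodge class pairs with `Algᵏ`, and the pairing split (`heightMassDefect_pairingSplit`)
concludes. [cite: BrosnanFangNiePearlstein2009, §6 Thm. 52] [cite: KerrPearlstein2011, Thm. 42] -/
theorem heightMassDefect_middle_of_sectionRestriction (hSR : SectionRestriction) {k : ℕ} (hk : 0 < k)
    {X : SchemeOver ℂ} (hX : IsSmoothProjective (2 * k) X)
    (hHC : ∀ ⦃m : ℕ⦄ ⦃Y : SchemeOver ℂ⦄, m < 2 * k → IsSmoothProjective m Y →
      ∀ (q : ℕ) (a : complexBetti Y (2 * q)), IsRationalClass a →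
        IsOfHodgeType m Y (2 * q) q q a → a ∈ algebraicClasses Y q)
    (c : complexBetti X (2 * k)) (hc : IsRationalClass c) (hh : IsOfHodgeType (2 * k) X (2 * k) k k c) :
    c ∈ algebraicClasses X k := by
  obtain ⟨m, rfl⟩ : ∃ m, k = m + 1 := ⟨k - 1, by omega⟩
  refine heightMassDefect_pairingSplit hX (fun c hc hh hne ↦ ?_) c hc hh
  by_contra hno
  push Not at hno
  -- a projective embedding of `X` and the hypersurface section supplied by the landing pad
  let e : ProjectiveEmbedding X := hX.isProjectiveOver.projectiveEmbedding
  obtain ⟨d, F, Z, -, -, hZ, hZu, hcZ⟩ := hSR hX e c hc hh hne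
  -- `Z` is Zariski-closed (preimage of a zero locus of the projective spectrum)
  have hZc : IsClosed Z := by
    letI := MvPolynomial.gradedAlgebra (σ := Fin (e.n + 1)) (R := ℂ)
    rw [hZ]
    exact (ProjectiveSpectrum.isClosed_zeroLocus _ _).preimage (Scheme.Hom.continuous _)
  exact hcZ (heightMassDefect_restrict_eq_zero_of_forall_cupProduct_eq_zero_of_lt hX hHC hc hh hno
    hZc hZu)

/-! ### The induction on the dimension -/

/-- **`SectionRestriction` ⟹ the Hodge conjecture in every dimension** (Kerr–Pearlstein 2011
Thm. 42 "if" + Thomas 2005 Prop. 2). Strong induction on the dimension `n`, inner induction on the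
codimension `p`: `p = 0` by `hodgeConjectureFor_codim_zero`; `0 < 2p < n` by the pencil step
(`mem_algebraicClasses_of_two_mul_le`, fed with the Hodge conjecture in dimension `n - 1`);
`2p = n` by the middle step (`heightMassDefect_middle_of_sectionRestriction`, fed with the Hodge
conjecture below `n`); `2p > n` by Andreotti–Frankel (`mem_supportedClasses_one_of_dim_lt`) and
divisor descent (`descent_of_divisorInduction` with the closed item
`limitExtension_divisorInduction_proof`); the Hodge model by `nonempty_hodgeModel_holds`.
[cite: KerrPearlstein2011, Thm. 42] [cite: Thomas2005Nodes, Prop. 2 (proof)]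
[cite: BrosnanFangNiePearlstein2009, §6 Lemma 48 and Thm. 52] [cite: DecataldoMigliorini2009, §4 Prop. 4.5] -/
theorem heightMassDefect_hodgeConjectureFor_of_sectionRestriction (hSR : SectionRestriction) :
    ∀ (n : ℕ) ⦃X : SchemeOver ℂ⦄, IsSmoothProjective n X → HodgeConjectureFor n X := by
  -- divisor descent (Deligne 8.2.7/8.2.8 + Gysin lift), from the closed item `DivisorInduction`
  have hDiv : ∀ ⦃n : ℕ⦄ ⦃X : SchemeOver ℂ⦄, IsSmoothProjective n X →
      (∀ ⦃m : ℕ⦄ ⦃Y : SchemeOver ℂ⦄, m < n → IsSmoothProjective m Y → HodgeConjectureFor m Y) →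
      ∀ (p : ℕ) (c : singularCohomology ℂ ℂ (ComplexPoints X) (2 * p)),
        IsRationalClass c → IsOfHodgeType n X (2 * p) p p c → c ∈ supportedClasses X (2 * p) 1 →
          c ∈ algebraicClasses X p := by
    refine descent_of_divisorInduction ?_
    have h := limitExtension_divisorInduction_proof
    unfold Summit.HodgeConjecture.HodgeConjecture.Theses.LimitExtension.DivisorInduction at h
    exact h
  intro n
  induction n using Nat.strong_induction_on with
  | _ n ihn =>
  -- the cycle statement in dimension `n`, by induction on the codimension `p`
  have hcyc : ∀ (p : ℕ) ⦃X : SchemeOver ℂ⦄, IsSmoothProjective n X →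
      ∀ c : complexBetti X (2 * p), IsRationalClass c → IsOfHodgeType n X (2 * p) p p c →
        c ∈ algebraicClasses X p := by
    intro p
    induction p with
    | zero => exact fun X _ c _ _ ↦ hodgeConjectureFor_codim_zero c
    | succ p' ihp =>
      intro X hX c hc hH
      have ih' : ∀ ⦃m : ℕ⦄ ⦃Y : SchemeOver ℂ⦄, m < n → IsSmoothProjective m Y →
          HodgeConjectureFor m Y := fun m Y hm hY ↦ ihn m hm hY
      rcases Nat.lt_trichotomy (2 * (p' + 1)) n with hlt | heq | hgt
      · -- below the middle: the pencil step (`n = m + 1`, `2 (p'+1) ≤ m`)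
        obtain ⟨m, rfl⟩ : ∃ m, n = m + 1 := ⟨n - 1, by omega⟩
        exact mem_algebraicClasses_of_two_mul_le hX
          (fun Y hY q c' hc' hH' ↦ (ihn m (Nat.lt_succ_self m) hY).2 q c' hc' hH')
          (p' + 1) c (by omega) hc hH
      · -- the middle: `SectionRestriction` + detection + pairing split
        subst heq
        exact heightMassDefect_middle_of_sectionRestriction hSR (Nat.succ_pos p') hX
          (fun m Y hm hY q a ha hH' ↦ (ihn m hm hY).2 q a ha hH') c hc hH
      · -- above the middle: supported on a hyperplane section (Andreotti–Frankel), then descent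
        exact hDiv hX ih' (p' + 1) c hc hH (mem_supportedClasses_one_of_dim_lt hX hgt c)
  exact fun X hX ↦ ⟨nonempty_hodgeModel_holds.nonempty hX, fun p c hc hH ↦ hcyc p hX c hc hH⟩

/-! ### The item -/

/-- **Item stmt-HodgeConjecture-2518 (`Assembly`, route `HeightMassDefect`), PROVED**:
`SectionRestriction → HodgeConjecture` — if every non-zero rational middle Hodge class on every
even-dimensional smooth projective complex variety restricts non-trivially to some hypersurface
section, then the Hodge conjecture holds (Kerr–Pearlstein 2011 Thm. 42 "if", without normal
functions, + Thomas 2005 Prop. 2). The type is literally the route decl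
`Summit.HodgeConjecture.HodgeConjecture.Theses.HeightMassDefect.Assembly`.
[cite: KerrPearlstein2011, Conj. 41 and Thm. 42] [cite: BrosnanFangNiePearlstein2009, §6 Thm. 52]
[cite: Thomas2005Nodes, Prop. 2] -/
theorem heightMassDefect_assembly_proof : Assembly := by
  intro hSR n X hX
  exact heightMassDefect_hodgeConjectureFor_of_sectionRestriction hSR n hX

/-- **`SectionRestriction` ⟺ `HodgeConjecture`** (Kerr–Pearlstein 2011, Conj. 41 / Thm. 42, both
directions now theorems of the tree: `heightMassDefect_assembly_proof` and the landed
`heightMassDefect_sectionRestriction_of_hodgeConjecture`). [cite: KerrPearlstein2011, Conj. 41 and Thm. 42]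
[cite: BrosnanFangNiePearlstein2009, §6 Lemma 50 and Thm. 52] -/
theorem heightMassDefect_sectionRestriction_iff_hodgeConjecture :
    SectionRestriction ↔ _root_.HodgeConjecture :=
  ⟨heightMassDefect_assembly_proof, heightMassDefect_sectionRestriction_of_hodgeConjecture⟩

end Summit.HodgeConjecture.HodgeConjecture.Theorems

end
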